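import Summits.AtomisticToContinuum.HydrodynamicLimit.Theses.OneFlightGossipEngine
import Summits.AtomisticToContinuum.HydrodynamicLimit.Theorems.TwoClocksClampedEntropyClockTimeZeroReference
import Literature.MathematicalPhysics.KineticTheory.HardSphereEulerProofs
import HarnessLib

/-!
# Crux `ClampedCurrentsDock` (stmt-AtomisticToContinuum-14680), line `IdeatorTwoSketch`: stub `stub_ledgerFromWindowsS`

Helper file (`--supports stmt-AtomisticToContinuum-14680`) proving the registered stub `stub_ledgerFromWindowsS :
LedgerFromWindowsS` of the lead's skeleton `Cruxes/ClampedCurrentsDock/Lines/IdeatorTwoSketch.lean` (v21/v22): the summation of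
Yau's one-window entropy ledger with the static telescoping (Yau 1991 §2). The propositions of §1 are VERBATIM copies of the
skeleton's, so its stub is this file's theorem definitionally. Proof: `ηp := min ηp₁ (r/2)`, `σ₀ := min σ₁ σ₂ σ_z (1/2)` (`σ_z`
from `QuenchedCellClock.stub_timeZeroReference`, so `H_N(0) = 0` by `EntropyClockDock.klDiv_lawAt_zero_localGibbsLaw`); rate
`2K`; for `ε > 0` the accuracy `e = ε/(4(1+t))` fixes `τ` (window clause) and then `N₀` (static clause, window continuity at
`τ`, the modulus of `Cst` on the compact `[0,t]`, `K w_N ≤ 1/2` since `w_N = τ(N+1)^{-1/3} → 0`). At fixed `N` everything is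
real analysis on functions `H, L, Cst` (§2): telescope the window clause over the grid `k w`, `n w ≤ t′ < (n+1) w`; the `log Z`
terms telescope and the static clause trades them for `−M∫₀^{nw} Cst + M e`, cancelled by the left Riemann sum `w M Σ Cst(kw)`
up to `M t e`; left Riemann sums of the monotone running supremum `S` are below `∫₀^{t′} S + w S(t′)`; the window continuity
reaches `t′`; the supremum over `t″ ≤ t′` and `K w ≤ 1/2` absorb the excess: `H(t′) ≤ S(t′) ≤ (N+1)·4(1+t)e + 2K∫₀^{t′} S`.
-/

noncomputable section

namespace Summit.AtomisticToContinuum.HydrodynamicLimit.Theorems.ClampedCurrentsDockFromWindows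

open scoped BigOperators ENNReal Classical Interval
open MeasureTheory Filter Set Topology InformationTheory
open Literature.MathematicalPhysics.KineticTheory Literature.Analysis.FluidPDE Literature.Analysis.FunctionSpaces
open Summit.AtomisticToContinuum.HydrodynamicLimit.Theses.OneFlightGossipEngine
open Summit.AtomisticToContinuum.HydrodynamicLimit.Theorems

/-! ### §1 The statements (verbatim from the line skeleton `Cruxes/ClampedCurrentsDock/Lines/IdeatorTwoSketch.lean`) -/

/-- registered stub signature S7a `LedgerAprioriBound` (input of `LedgerFromWindowsS`: the a-priori entropy bound along the
explicit reference family) of line IdeatorTwoSketch, crux ClampedCurrentsDock — route-internal, not a cited fact -/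
def LedgerAprioriBound : Prop :=
  ∀ (r : ℝ) (Rf : ℝ → ℝ), 0 < r → (∀ x ∈ Icc 0 r, 1 ≤ Rf x ∧ Rf x ≤ 2) → ContinuousOn Rf (Icc 0 r) →
    ∀ (a₀ θ₀ : T3 → ℝ) (u₀ : T3 → V3), Continuous a₀ → Continuous θ₀ → Continuous u₀ →
      (∀ x, 0 < a₀ x) → (∀ x, 0 < θ₀ x) →
      ∀ σ : ℝ, 0 < σ → σ < 1 / 2 →
        ∀ (T : ℝ) (ρ θ : ℝ → T3 → ℝ) (u : ℝ → T3 → V3), IsHardSphereEulerSolution σ T ρ u θ →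
          ∀ t ∈ Set.Ioo 0 T, (∀ s ∈ Set.Icc 0 t, ∀ x, ρ s x * σ ^ 3 < r) →
            ∀ (N : ℕ) (Φ : HardSphereFlow (Torus.geometry (Fin 3)) (hsDiameter σ N) (N + 1)),
              ∃ B : ℝ, ∀ s ∈ Set.Icc 0 t,
                klDiv (Φ.lawAt (localGibbsLaw σ a₀ u₀ θ₀ N Φ) s)
                  (localGibbsLaw σ (fun x => ρ s x * Rf (σ ^ 3 * ρ s x)) (u s) (θ s) N Φ) ≤ ENNReal.ofReal B

/-- registered stub signature `LedgerIntegratedCoreInBand` (conclusion of `LedgerFromWindowsS`: the integrated ledger in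
band) of line IdeatorTwoSketch, crux ClampedCurrentsDock — route-internal, not a cited fact -/
def LedgerIntegratedCoreInBand : Prop :=
  ∀ (r : ℝ) (Rf : ℝ → ℝ), 0 < r →
    (∃ p : FormalMultilinearSeries ℝ ℝ ℝ, HasFPowerSeriesOnBall Rf p 0 (ENNReal.ofReal r)) →
    (∃ L : NNReal, LipschitzOnWith L Rf (Icc 0 r)) →
    (∀ x ∈ Ioo (-r) r, 0 < Rf x ∧ Rf x * (∑' j : ℕ, bE j / (j.factorial : ℝ) * (x * Rf x) ^ j) = 1) →
    (∀ x ∈ Icc 0 r, 1 ≤ Rf x ∧ Rf x ≤ 2) → ContinuousOn Rf (Icc 0 r) →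
    (∀ x ∈ Ioo (-r) r, ∀ R ∈ Icc (1 / 2 : ℝ) 2,
      R * (∑' j : ℕ, bE j / (j.factorial : ℝ) * (x * R) ^ j) = 1 → R = Rf x) →
    ∀ η₀ : ℝ, 0 < η₀ →
    (∀ (a θ₀ : T3 → ℝ) (u₀ : T3 → V3), Continuous a → Continuous θ₀ → Continuous u₀ → (∀ x, 0 < a x) →
      (∀ x, 0 < θ₀ x) → ∀ σ : ℝ, 0 < σ → σ ^ 3 * (⨆ x, a x) ≤ η₀ * ∫ x, a x →
      ∃ ρ₀ : T3 → ℝ, Continuous ρ₀ ∧ (∀ x, 0 < ρ₀ x) ∧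
        (∀ (N : ℕ) (Φ : HardSphereFlow (Torus.geometry (Fin 3)) (hsDiameter σ N) (N + 1)),
          IsProbabilityMeasure (localGibbsLaw σ a u₀ θ₀ N Φ)) ∧
        ∀ χ : T3 → ℝ, Continuous χ → ∀ δ : ℝ, 0 < δ → ∃ C : ℝ, 0 < C ∧
          ∀ (N : ℕ) (Φ : HardSphereFlow (Torus.geometry (Fin 3)) (hsDiameter σ N) (N + 1)),
            localGibbsLaw σ a u₀ θ₀ N Φ {z | δ < |empiricalDensityField z χ - ∫ x, χ x * ρ₀ x|} ≤
                ENNReal.ofReal (C * Real.exp (-(C⁻¹ * ((N : ℝ) + 1)))) ∧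
              localGibbsLaw σ a u₀ θ₀ N Φ
                  {z | δ < ‖empiricalMomentumField z χ - ∫ x, (χ x * ρ₀ x) • u₀ x‖} ≤
                ENNReal.ofReal (C * Real.exp (-(C⁻¹ * ((N : ℝ) + 1)))) ∧
              localGibbsLaw σ a u₀ θ₀ N Φ {z | δ < |empiricalEnergyField z χ -
                  ∫ x, χ x * totalEnergyDensity (ρ₀ x) (u₀ x) (θ₀ x)|} ≤
                ENNReal.ofReal (C * Real.exp (-(C⁻¹ * ((N : ℝ) + 1))))) →
    ∃ ηp : ℝ, 0 < ηp ∧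
    ∀ (a₀ θ₀ : T3 → ℝ) (u₀ : T3 → V3), Continuous a₀ → Continuous θ₀ → Continuous u₀ →
      (∀ x, 0 < a₀ x) → (∀ x, 0 < θ₀ x) →
      ∃ σ₀ : ℝ, 0 < σ₀ ∧ ∀ σ : ℝ, 0 < σ → σ < σ₀ →
        ∀ (T : ℝ) (ρ θ : ℝ → T3 → ℝ) (u : ℝ → T3 → V3), IsHardSphereEulerSolution σ T ρ u θ →
          (∀ s ∈ Set.Ico 0 T, ∀ x, ρ s x * σ ^ 3 < ηp) →
          ∀ Φ : (N : ℕ) → HardSphereFlow (Torus.geometry (Fin 3)) (hsDiameter σ N) (N + 1),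
            TendstoHydroFieldsAt (fun N => localGibbsLaw σ a₀ u₀ θ₀ N (Φ N)) Φ ρ u θ 0 →
            ∀ t ∈ Set.Ioo 0 T,
              ∃ K : ℝ, 0 ≤ K ∧ ∀ ε : ℝ, 0 < ε → ∃ N₀ : ℕ, ∀ N : ℕ, N₀ ≤ N → ∀ t' ∈ Set.Icc 0 t,
                (klDiv ((Φ N).lawAt (localGibbsLaw σ a₀ u₀ θ₀ N (Φ N)) t')
                  (localGibbsLaw σ (fun x => ρ t' x * Rf (σ ^ 3 * ρ t' x)) (u t') (θ t') N (Φ N))).toReal ≤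
                ((N : ℝ) + 1) * ε + K * ∫ r in (0 : ℝ)..t',
                  sSup ((fun s => (klDiv ((Φ N).lawAt (localGibbsLaw σ a₀ u₀ θ₀ N (Φ N)) s)
                    (localGibbsLaw σ (fun x => ρ s x * Rf (σ ^ 3 * ρ s x)) (u s) (θ s) N (Φ N))).toReal) ''
                    Set.Icc 0 r)

/-- registered stub signature `WindowContinuityInBand` (input of `LedgerFromWindowsS`: crude short-time continuity of
`H_N` along the reference family) of line IdeatorTwoSketch, crux ClampedCurrentsDock — route-internal, not a cited fact -/
def WindowContinuityInBand : Prop :=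
  ∀ (r : ℝ) (Rf : ℝ → ℝ), 0 < r → (∀ x ∈ Icc 0 r, 1 ≤ Rf x ∧ Rf x ≤ 2) →
    (∃ L : NNReal, LipschitzOnWith L Rf (Icc 0 r)) →
    ∀ (a₀ θ₀ : T3 → ℝ) (u₀ : T3 → V3), Continuous a₀ → Continuous θ₀ → Continuous u₀ →
      (∀ x, 0 < a₀ x) → (∀ x, 0 < θ₀ x) →
      ∃ σ₀ : ℝ, 0 < σ₀ ∧ ∀ σ : ℝ, 0 < σ → σ < σ₀ →
        ∀ (T : ℝ) (ρ θ : ℝ → T3 → ℝ) (u : ℝ → T3 → V3), IsHardSphereEulerSolution σ T ρ u θ →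
          ∀ Φ : (N : ℕ) → HardSphereFlow (Torus.geometry (Fin 3)) (hsDiameter σ N) (N + 1),
            TendstoHydroFieldsAt (fun N => localGibbsLaw σ a₀ u₀ θ₀ N (Φ N)) Φ ρ u θ 0 →
            ∀ t ∈ Set.Ioo 0 T, (∀ s ∈ Set.Icc 0 t, ∀ x, ρ s x * σ ^ 3 < r) →
              ∀ τ : ℝ, 0 < τ → ∀ ε : ℝ, 0 < ε → ∃ N₀ : ℕ, ∀ N : ℕ, N₀ ≤ N →
                ∀ s ∈ Set.Icc 0 t, ∀ s' ∈ Set.Icc 0 t, s ≤ s' → s' ≤ s + τ * ((N : ℝ) + 1) ^ (-(1 / 3 : ℝ)) →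
                  |(klDiv ((Φ N).lawAt (localGibbsLaw σ a₀ u₀ θ₀ N (Φ N)) s')
                      (localGibbsLaw σ (fun x => ρ s' x * Rf (σ ^ 3 * ρ s' x)) (u s') (θ s') N (Φ N))).toReal -
                    (klDiv ((Φ N).lawAt (localGibbsLaw σ a₀ u₀ θ₀ N (Φ N)) s)
                      (localGibbsLaw σ (fun x => ρ s x * Rf (σ ^ 3 * ρ s x)) (u s) (θ s) N (Φ N))).toReal| ≤
                  ((N : ℝ) + 1) * ε

/-- registered stub signature `OneWindowLedgerStatic` (THE HEART, input of `LedgerFromWindowsS`: the one-window entropy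
ledger in band, END-supremum form, with the static telescoping clause for `log Z_pos` against the rate `Cst`) of line
IdeatorTwoSketch, crux ClampedCurrentsDock — route-internal, not a cited fact -/
def OneWindowLedgerStatic : Prop :=
  ∀ (r : ℝ) (Rf : ℝ → ℝ), 0 < r →
    (∃ p : FormalMultilinearSeries ℝ ℝ ℝ, HasFPowerSeriesOnBall Rf p 0 (ENNReal.ofReal r)) →
    (∃ L : NNReal, LipschitzOnWith L Rf (Icc 0 r)) →
    (∀ x ∈ Ioo (-r) r, 0 < Rf x ∧ Rf x * (∑' j : ℕ, bE j / (j.factorial : ℝ) * (x * Rf x) ^ j) = 1) →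
    (∀ x ∈ Icc 0 r, 1 ≤ Rf x ∧ Rf x ≤ 2) → ContinuousOn Rf (Icc 0 r) →
    (∀ x ∈ Ioo (-r) r, ∀ R ∈ Icc (1 / 2 : ℝ) 2,
      R * (∑' j : ℕ, bE j / (j.factorial : ℝ) * (x * R) ^ j) = 1 → R = Rf x) →
    ∀ η₀ : ℝ, 0 < η₀ →
    (∀ (a θ₀ : T3 → ℝ) (u₀ : T3 → V3), Continuous a → Continuous θ₀ → Continuous u₀ → (∀ x, 0 < a x) →
      (∀ x, 0 < θ₀ x) → ∀ σ : ℝ, 0 < σ → σ ^ 3 * (⨆ x, a x) ≤ η₀ * ∫ x, a x →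
      ∃ ρ₀ : T3 → ℝ, Continuous ρ₀ ∧ (∀ x, 0 < ρ₀ x) ∧
        (∀ (N : ℕ) (Φ : HardSphereFlow (Torus.geometry (Fin 3)) (hsDiameter σ N) (N + 1)),
          IsProbabilityMeasure (localGibbsLaw σ a u₀ θ₀ N Φ)) ∧
        ∀ χ : T3 → ℝ, Continuous χ → ∀ δ : ℝ, 0 < δ → ∃ C : ℝ, 0 < C ∧
          ∀ (N : ℕ) (Φ : HardSphereFlow (Torus.geometry (Fin 3)) (hsDiameter σ N) (N + 1)),
            localGibbsLaw σ a u₀ θ₀ N Φ {z | δ < |empiricalDensityField z χ - ∫ x, χ x * ρ₀ x|} ≤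
                ENNReal.ofReal (C * Real.exp (-(C⁻¹ * ((N : ℝ) + 1)))) ∧
              localGibbsLaw σ a u₀ θ₀ N Φ
                  {z | δ < ‖empiricalMomentumField z χ - ∫ x, (χ x * ρ₀ x) • u₀ x‖} ≤
                ENNReal.ofReal (C * Real.exp (-(C⁻¹ * ((N : ℝ) + 1)))) ∧
              localGibbsLaw σ a u₀ θ₀ N Φ {z | δ < |empiricalEnergyField z χ -
                  ∫ x, χ x * totalEnergyDensity (ρ₀ x) (u₀ x) (θ₀ x)|} ≤
                ENNReal.ofReal (C * Real.exp (-(C⁻¹ * ((N : ℝ) + 1))))) →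
    ∃ ηp : ℝ, 0 < ηp ∧
    ∀ (a₀ θ₀ : T3 → ℝ) (u₀ : T3 → V3), Continuous a₀ → Continuous θ₀ → Continuous u₀ →
      (∀ x, 0 < a₀ x) → (∀ x, 0 < θ₀ x) →
      ∃ σ₀ : ℝ, 0 < σ₀ ∧ ∀ σ : ℝ, 0 < σ → σ < σ₀ →
        ∀ (T : ℝ) (ρ θ : ℝ → T3 → ℝ) (u : ℝ → T3 → V3), IsHardSphereEulerSolution σ T ρ u θ →
          (∀ s ∈ Set.Ico 0 T, ∀ x, ρ s x * σ ^ 3 < ηp) →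
          ∀ Φ : (N : ℕ) → HardSphereFlow (Torus.geometry (Fin 3)) (hsDiameter σ N) (N + 1),
            TendstoHydroFieldsAt (fun N => localGibbsLaw σ a₀ u₀ θ₀ N (Φ N)) Φ ρ u θ 0 →
            ∀ t ∈ Set.Ioo 0 T,
              ∃ K : ℝ, 0 ≤ K ∧ ∃ Cst : ℝ → ℝ, ContinuousOn Cst (Set.Icc 0 t) ∧
                (∀ ε : ℝ, 0 < ε → ∃ N₀ : ℕ, ∀ N : ℕ, N₀ ≤ N → ∀ t' ∈ Set.Icc 0 t,
                  |Real.log (posPartition (fun x => ρ t' x * Rf (σ ^ 3 * ρ t' x)) (hsDiameter σ N) (N + 1)) -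
                      Real.log (posPartition (fun x => ρ 0 x * Rf (σ ^ 3 * ρ 0 x)) (hsDiameter σ N) (N + 1)) +
                    ((N : ℝ) + 1) * ∫ r in (0 : ℝ)..t', Cst r| ≤ ((N : ℝ) + 1) * ε) ∧
                ∀ ε : ℝ, 0 < ε → ∃ τ : ℝ, 0 < τ ∧ ∃ N₀ : ℕ, ∀ N : ℕ, N₀ ≤ N →
                ∀ s : ℝ, 0 ≤ s → s + τ * ((N : ℝ) + 1) ^ (-(1 / 3 : ℝ)) ≤ t →
                (klDiv ((Φ N).lawAt (localGibbsLaw σ a₀ u₀ θ₀ N (Φ N)) (s + τ * ((N : ℝ) + 1) ^ (-(1 / 3 : ℝ))))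
                  (localGibbsLaw σ (fun x => ρ (s + τ * ((N : ℝ) + 1) ^ (-(1 / 3 : ℝ))) x *
                      Rf (σ ^ 3 * ρ (s + τ * ((N : ℝ) + 1) ^ (-(1 / 3 : ℝ))) x))
                    (u (s + τ * ((N : ℝ) + 1) ^ (-(1 / 3 : ℝ)))) (θ (s + τ * ((N : ℝ) + 1) ^ (-(1 / 3 : ℝ))))
                    N (Φ N))).toReal ≤
                (klDiv ((Φ N).lawAt (localGibbsLaw σ a₀ u₀ θ₀ N (Φ N)) s)
                  (localGibbsLaw σ (fun x => ρ s x * Rf (σ ^ 3 * ρ s x)) (u s) (θ s) N (Φ N))).toReal +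
                K * (τ * ((N : ℝ) + 1) ^ (-(1 / 3 : ℝ))) *
                  sSup ((fun s' => (klDiv ((Φ N).lawAt (localGibbsLaw σ a₀ u₀ θ₀ N (Φ N)) s')
                    (localGibbsLaw σ (fun x => ρ s' x * Rf (σ ^ 3 * ρ s' x)) (u s') (θ s') N (Φ N))).toReal) ''
                    Set.Icc 0 (s + τ * ((N : ℝ) + 1) ^ (-(1 / 3 : ℝ)))) +
                (τ * ((N : ℝ) + 1) ^ (-(1 / 3 : ℝ))) * ((N : ℝ) + 1) * ε +
                ((Real.log (posPartition (fun x => ρ (s + τ * ((N : ℝ) + 1) ^ (-(1 / 3 : ℝ))) x *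
                      Rf (σ ^ 3 * ρ (s + τ * ((N : ℝ) + 1) ^ (-(1 / 3 : ℝ))) x)) (hsDiameter σ N) (N + 1)) -
                    Real.log (posPartition (fun x => ρ s x * Rf (σ ^ 3 * ρ s x)) (hsDiameter σ N) (N + 1))) +
                  (τ * ((N : ℝ) + 1) ^ (-(1 / 3 : ℝ))) * ((N : ℝ) + 1) * Cst s)

/-- registered stub signature `LedgerFromWindowsS` (this file's stub `stub_ledgerFromWindowsS`) of line IdeatorTwoSketch,
crux ClampedCurrentsDock — route-internal, not a cited fact -/
def LedgerFromWindowsS : Prop :=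
  OneWindowLedgerStatic → WindowContinuityInBand → LedgerAprioriBound → LedgerIntegratedCoreInBand

/-! ### §2 Generic real analysis: telescoping, Riemann sums, the running supremum -/

section RealAnalysis

variable {H L Cst S : ℝ → ℝ} {t M K w e B : ℝ}

/-- **Telescoping the window clause over the grid `s_k = k w`** (`H(0) = 0`): for `k w ≤ t`,
`H(k w) ≤ K w Σ_{j<k} S((j+1) w) + k w M e + [L(k w) − L(0)] + w M Σ_{j<k} Cst(j w)`. [folklore] -/
theorem telescope_windows (hH0 : H 0 = 0) (hw : 0 ≤ w)
    (hwin : ∀ s, 0 ≤ s → s + w ≤ t →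
      H (s + w) ≤ H s + K * w * S (s + w) + w * M * e + ((L (s + w) - L s) + w * M * Cst s)) :
    ∀ k : ℕ, (k : ℝ) * w ≤ t →
      H (k * w) ≤ K * w * ∑ j ∈ Finset.range k, S ((j + 1) * w) + k * w * M * e + (L (k * w) - L 0) +
        w * M * ∑ j ∈ Finset.range k, Cst (j * w) := by
  intro k
  induction k with
  | zero => intro; simp [hH0]
  | succ k ih =>
    intro hk
    push_cast at hk ⊢
    have hk0 : (0 : ℝ) ≤ k * w := by positivity
    have h2 := hwin (k * w) hk0 (by linarith)
    rw [show (k : ℝ) * w + w = (k + 1) * w by ring] at h2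
    rw [Finset.sum_range_succ, Finset.sum_range_succ]
    linarith [ih (by linarith)]

/-- One grid cell: `|∫_a^{a+w} Cst − w Cst(a)| ≤ w e` when `|Cst y − Cst a| ≤ e` on `[a, a + w]`. [folklore] -/
theorem abs_integral_sub_mul_le {a : ℝ} (hw : 0 ≤ w) (hi : IntervalIntegrable Cst volume a (a + w))
    (h : ∀ y ∈ Icc a (a + w), |Cst y - Cst a| ≤ e) : |(∫ r in a..(a + w), Cst r) - w * Cst a| ≤ w * e := by
  have hc : (∫ _ in a..(a + w), Cst a) = w * Cst a := by rw [intervalIntegral.integral_const, smul_eq_mul]; ring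
  rw [← hc, ← intervalIntegral.integral_sub hi intervalIntegrable_const]
  have hb := intervalIntegral.norm_integral_le_of_norm_le_const (C := e) (f := fun r => Cst r - Cst a) (a := a)
    (b := a + w) fun x hx => by
      rw [uIoc_of_le (by linarith)] at hx
      rw [Real.norm_eq_abs]
      exact h x ⟨hx.1.le, hx.2⟩
  rwa [Real.norm_eq_abs, add_sub_cancel_left, abs_of_nonneg hw, mul_comm] at hb

/-- **Left Riemann sums on the grid of a function with modulus `e` at scale `w` on `[0, t]`:** for `n w ≤ t`,
`|w Σ_{j<n} Cst(j w) − ∫₀^{n w} Cst| ≤ n w e`. [folklore] -/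
theorem riemann_windows (hw : 0 ≤ w) (hCst : ContinuousOn Cst (Icc 0 t))
    (hUC : ∀ x ∈ Icc 0 t, ∀ y ∈ Icc 0 t, x ≤ y → y ≤ x + w → |Cst y - Cst x| ≤ e) :
    ∀ n : ℕ, (n : ℝ) * w ≤ t →
      |w * ∑ j ∈ Finset.range n, Cst (j * w) - ∫ r in (0 : ℝ)..(n * w), Cst r| ≤ n * w * e := by
  intro n
  induction n with
  | zero => intro; simp
  | succ n ih =>
    intro hn
    push_cast at hn ⊢
    have hn0 : (0 : ℝ) ≤ n * w := by positivity
    have hn' : (n : ℝ) * w ≤ t := by linarith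
    have hi : ∀ a b : ℝ, 0 ≤ a → a ≤ b → b ≤ t → IntervalIntegrable Cst volume a b := fun a b ha hab hbt =>
      (hCst.mono (Icc_subset_Icc ha hbt)).intervalIntegrable_of_Icc hab
    have hcell := abs_integral_sub_mul_le hw (hi _ _ hn0 (by linarith) (by linarith))
      fun y hy => hUC _ ⟨hn0, hn'⟩ y ⟨hn0.trans hy.1, hy.2.trans (by linarith)⟩ hy.1 hy.2
    rw [show (n : ℝ) * w + w = (n + 1) * w by ring] at hcell
    rw [Finset.sum_range_succ, ← intervalIntegral.integral_add_adjacent_intervals (b := (n : ℝ) * w)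
      (hi _ _ le_rfl hn0 hn') (hi _ _ hn0 (by linarith) hn)]
    calc _ = |(w * ∑ j ∈ Finset.range n, Cst (j * w) - ∫ r in (0 : ℝ)..(n * w), Cst r) -
          ((∫ r in (n * w : ℝ)..((n + 1) * w), Cst r) - w * Cst (n * w))| := by congr 1; ring
      _ ≤ _ := abs_sub _ _
      _ ≤ n * w * e + w * e := add_le_add (ih hn') hcell
      _ = (n + 1) * w * e := by ring

/-- **Left Riemann sums of a monotone function are below its integral:** `w Σ_{j<n} S(j w) ≤ ∫₀^{n w} S` for `S` monotone on
`[0, t]` and `n w ≤ t`. [folklore] -/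
theorem sum_mono_le_integral (hw : 0 ≤ w) (hmono : MonotoneOn S (Icc 0 t)) :
    ∀ n : ℕ, (n : ℝ) * w ≤ t → w * ∑ j ∈ Finset.range n, S (j * w) ≤ ∫ r in (0 : ℝ)..(n * w), S r := by
  intro n
  induction n with
  | zero => intro; simp
  | succ n ih =>
    intro hn
    push_cast at hn ⊢
    have hn0 : (0 : ℝ) ≤ n * w := by positivity
    have hn' : (n : ℝ) * w ≤ t := by linarith
    have hi : ∀ a b : ℝ, 0 ≤ a → a ≤ b → b ≤ t → IntervalIntegrable S volume a b := fun a b ha hab hbt =>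
      (hmono.mono (by rw [uIcc_of_le hab]; exact Icc_subset_Icc ha hbt)).intervalIntegrable
    rw [Finset.sum_range_succ, mul_add, ← intervalIntegral.integral_add_adjacent_intervals (b := (n : ℝ) * w)
      (hi _ _ le_rfl hn0 hn') (hi _ _ hn0 (by linarith) hn)]
    refine add_le_add (ih hn') ?_
    calc w * S (n * w) = ∫ _ in (n * w : ℝ)..((n + 1) * w), S (n * w) := by
          rw [intervalIntegral.integral_const, smul_eq_mul]; ring
      _ ≤ ∫ r in (n * w : ℝ)..((n + 1) * w), S r :=
          intervalIntegral.integral_mono_on (by linarith) intervalIntegrable_const (hi _ _ hn0 (by linarith) hn)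
            fun x hx => hmono ⟨hn0, hn'⟩ ⟨hn0.trans hx.1, hx.2.trans hn⟩ hx.1

/-- **The summation of the window ledger (real analysis; Yau's bookkeeping).** `H ≥ 0` bounded on `[0, t]`, `H(0) = 0`;
a window `w > 0` with `K w ≤ 1/2`; the window clause `H(s+w) ≤ H(s) + K w sup_{[0,s+w]} H + w M e + [L(s+w) − L(s)] +
w M Cst(s)` on `[s, s+w] ⊆ [0, t]`; the static clause `|L(t′) − L(0) + M∫₀^{t′} Cst| ≤ M e`; the window continuity
`|H(s′) − H(s)| ≤ M e` for `0 ≤ s′ − s ≤ w`; `Cst` continuous on `[0, t]` with modulus `e` at scale `w`. Then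
`H(t′) ≤ M·4(1+t)e + 2K∫₀^{t′} sup_{[0,r]} H` on `[0, t]`. [cite: Yau1991, §2] -/
theorem integrated_of_windows (hM : 0 ≤ M) (hK : 0 ≤ K) (hw : 0 < w) (he : 0 ≤ e) (hKw : K * w ≤ 1 / 2)
    (hHnn : ∀ s, 0 ≤ H s) (hHB : ∀ s ∈ Icc 0 t, H s ≤ B) (hH0 : H 0 = 0)
    (hwin : ∀ s, 0 ≤ s → s + w ≤ t →
      H (s + w) ≤ H s + K * w * sSup (H '' Icc 0 (s + w)) + w * M * e + ((L (s + w) - L s) + w * M * Cst s))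
    (hstat : ∀ t' ∈ Icc 0 t, |L t' - L 0 + M * ∫ r in (0 : ℝ)..t', Cst r| ≤ M * e)
    (hcont : ∀ s ∈ Icc 0 t, ∀ s' ∈ Icc 0 t, s ≤ s' → s' ≤ s + w → |H s' - H s| ≤ M * e)
    (hCst : ContinuousOn Cst (Icc 0 t)) (hUC : ∀ x ∈ Icc 0 t, ∀ y ∈ Icc 0 t, x ≤ y → y ≤ x + w → |Cst y - Cst x| ≤ e)
    {t' : ℝ} (ht' : t' ∈ Icc 0 t) : H t' ≤ M * (4 * (1 + t) * e) + 2 * K * ∫ r in (0 : ℝ)..t', sSup (H '' Icc 0 r) := by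
  -- the running supremum `S` and its bookkeeping on `[0, t]`
  set S : ℝ → ℝ := fun r => sSup (H '' Icc 0 r) with hS
  have hbdd : ∀ r ∈ Icc 0 t, BddAbove (H '' Icc 0 r) := fun r hr =>
    ⟨B, by rintro y ⟨s, hs, rfl⟩; exact hHB s ⟨hs.1, hs.2.trans hr.2⟩⟩
  have hne : ∀ r : ℝ, 0 ≤ r → (H '' Icc 0 r).Nonempty := fun r hr => ⟨H 0, 0, ⟨le_rfl, hr⟩, rfl⟩
  have hHS : ∀ r ∈ Icc 0 t, H r ≤ S r := fun r hr => le_csSup (hbdd r hr) ⟨r, ⟨hr.1, le_rfl⟩, rfl⟩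
  have hSnn : ∀ r, 0 ≤ S r := fun r => Real.sSup_nonneg (by rintro _ ⟨s, -, rfl⟩; exact hHnn s)
  have hmono : MonotoneOn S (Icc 0 t) := fun r₁ hr₁ r₂ hr₂ h12 =>
    csSup_le_csSup (hbdd r₂ hr₂) (hne r₁ hr₁.1) (image_mono (Icc_subset_Icc le_rfl h12))
  have hImono : ∀ a b : ℝ, 0 ≤ a → a ≤ b → b ≤ t → ∫ r in (0 : ℝ)..a, S r ≤ ∫ r in (0 : ℝ)..b, S r :=
    fun a b ha hab hbt => intervalIntegral.integral_mono_interval le_rfl ha hab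
      (Filter.Eventually.of_forall fun x => hSnn x)
      (hmono.mono (by rw [uIcc_of_le (ha.trans hab)]; exact Icc_subset_Icc le_rfl hbt)).intervalIntegrable
  -- Step 1: the bound with the end-supremum excess `K w S(t'')`, for every `t'' ∈ [0, t]`
  have hpre : ∀ t' ∈ Icc 0 t, H t' ≤ M * e * (2 + 2 * t) + K * (∫ r in (0 : ℝ)..t', S r) + K * w * S t' := by
    rintro t' ⟨ht'0, ht't⟩
    have hnw : (⌊t' / w⌋₊ : ℝ) * w ≤ t' := by rw [← le_div_iff₀ hw]; exact Nat.floor_le (div_nonneg ht'0 hw.le)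
    have hlt : t' < ((⌊t' / w⌋₊ : ℝ) + 1) * w := by rw [← div_lt_iff₀ hw]; exact Nat.lt_floor_add_one _
    generalize ⌊t' / w⌋₊ = n at hnw hlt
    have hnwt : (n : ℝ) * w ≤ t := hnw.trans ht't
    have hnw0 : (0 : ℝ) ≤ n * w := by positivity
    have hnt : (n : ℝ) * w * (M * e) ≤ t * (M * e) := mul_le_mul_of_nonneg_right hnwt (mul_nonneg hM he)
    have htel := telescope_windows (S := S) hH0 hw.le hwin n hnwt
    have hst := (abs_le.1 (hstat (n * w) ⟨hnw0, hnwt⟩)).2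
    have hrie0 := (abs_le.1 (riemann_windows hw.le hCst hUC n hnwt)).2
    have hte : (n : ℝ) * w * e ≤ t * e := mul_le_mul_of_nonneg_right hnwt he
    have hrie : M * (w * ∑ j ∈ Finset.range n, Cst (j * w)) ≤ M * ((∫ r in (0 : ℝ)..(n * w), Cst r) + t * e) :=
      mul_le_mul_of_nonneg_left (by linarith) hM
    have hshift : ∑ j ∈ Finset.range (n + 1), S (j * w) = ∑ j ∈ Finset.range n, S ((j + 1) * w) + S 0 := by
      simp only [Finset.sum_range_succ', Nat.cast_add, Nat.cast_one, Nat.cast_zero, zero_mul]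
    rw [Finset.sum_range_succ] at hshift
    have hsum : K * (w * ∑ j ∈ Finset.range n, S ((j + 1) * w)) ≤ K * ((∫ r in (0 : ℝ)..t', S r) + w * S t') := by
      refine mul_le_mul_of_nonneg_left ?_ hK
      have h1 : w * ∑ j ∈ Finset.range n, S ((j + 1) * w) ≤ w * (∑ j ∈ Finset.range n, S (j * w) + S (n * w)) :=
        mul_le_mul_of_nonneg_left (by linarith [hSnn 0]) hw.le
      have h3 : w * S (n * w) ≤ w * S t' := mul_le_mul_of_nonneg_left (hmono ⟨hnw0, hnwt⟩ ⟨ht'0, ht't⟩ hnw) hw.le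
      linarith [sum_mono_le_integral hw.le hmono n hnwt, hImono (n * w) t' hnw0 hnw ht't]
    have hco := (abs_le.1 (hcont (n * w) ⟨hnw0, hnwt⟩ t' ⟨ht'0, ht't⟩ hnw (by linarith))).2
    linarith
  -- Step 2: pass to the supremum over `t'' ≤ t'` and absorb the end-supremum excess (`K w ≤ 1/2`)
  have hSle : S t' ≤ M * e * (2 + 2 * t) + K * (∫ r in (0 : ℝ)..t', S r) + K * w * S t' := by
    refine csSup_le (hne t' ht'.1) ?_
    rintro _ ⟨s, hs, rfl⟩
    have hst : s ∈ Icc 0 t := ⟨hs.1, hs.2.trans ht'.2⟩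
    have h2 := mul_le_mul_of_nonneg_left (hImono s t' hs.1 hs.2 ht'.2) hK
    have h3 := mul_le_mul_of_nonneg_left (hmono hst ht' hs.2) (mul_nonneg hK hw.le)
    linarith [hpre s hst]
  have hKwS : K * w * S t' ≤ 1 / 2 * S t' := mul_le_mul_of_nonneg_right hKw (hSnn t')
  linarith [hHS t' ht']

end RealAnalysis

/-- **STUB `stub_ledgerFromWindowsS` of line `IdeatorTwoSketch` (crux `ClampedCurrentsDock`, stmt-14680): the one-window
ledger with the static telescoping, the window continuity and the a-priori bound imply the integrated ledger in band.**
`ηp := min ηp₁ (r/2)`, `σ₀ := min σ₁ (min σ₂ (min σ_z (1/2)))` (`σ_z`: `QuenchedCellClock.stub_timeZeroReference`, so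
`H_N(0) = 0`), rate `2K`, accuracy `e = ε/(4(1+t))`, then `τ` and `N₀` as in the module docstring; conclude by
`integrated_of_windows` at fixed `N`. [cite: Yau1991, §2] -/
theorem stub_ledgerFromWindowsS : LedgerFromWindowsS := by
  intro hW hWC hA r Rf hr hps hLip hsol hbd hcont huniq η₀ hη₀ HU
  obtain ⟨ηp₁, hηp₁, H1p⟩ := hW r Rf hr hps hLip hsol hbd hcont huniq η₀ hη₀ HU
  refine ⟨min ηp₁ (r / 2), lt_min hηp₁ (half_pos hr), fun a₀ θ₀ u₀ ha hθ hu ha0 hθ0 => ?_⟩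
  obtain ⟨σ₁, hσ₁, H1⟩ := H1p a₀ θ₀ u₀ ha hθ hu ha0 hθ0
  obtain ⟨σ₂, hσ₂, H2⟩ := hWC r Rf hr hbd hLip a₀ θ₀ u₀ ha hθ hu ha0 hθ0
  obtain ⟨σ₃, hσ₃, H3⟩ := QuenchedCellClock.stub_timeZeroReference hr hsol hbd hcont huniq a₀ θ₀ u₀ ha hθ hu ha0 hθ0
  refine ⟨min σ₁ (min σ₂ (min σ₃ (1 / 2))), lt_min hσ₁ (lt_min hσ₂ (lt_min hσ₃ (by norm_num))), ?_⟩
  intro σ hσ hσlt T ρ θ u hEul hguard Φ htie t ht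
  simp only [lt_min_iff] at hσlt
  obtain ⟨hσ1, hσ2, hσ3, hσh⟩ := hσlt
  have hguard₁ : ∀ s ∈ Set.Ico 0 T, ∀ x, ρ s x * σ ^ 3 < ηp₁ := fun s hs x =>
    (hguard s hs x).trans_le (min_le_left _ _)
  have hpack : ∀ s ∈ Set.Icc 0 t, ∀ x, ρ s x * σ ^ 3 < r := fun s hs x =>
    ((hguard s ⟨hs.1, hs.2.trans_lt ht.2⟩ x).trans_le (min_le_right _ _)).trans (half_lt_self hr)
  obtain ⟨K, hK, Cst, hCst, hstat, hwin⟩ := H1 σ hσ hσ1 T ρ θ u hEul hguard₁ Φ htie t ht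
  have hcw := H2 σ hσ hσ2 T ρ θ u hEul Φ htie t ht hpack
  have hlaw0 := H3 σ hσ hσ3 T ρ θ u hEul (ht.1.trans ht.2) Φ htie
  refine ⟨2 * K, by positivity, fun ε hε => ?_⟩
  have ht0 : 0 < t := ht.1
  set e : ℝ := ε / (4 * (1 + t)) with he_def
  have he : 0 < e := by positivity
  obtain ⟨τ, hτ, N₁, hN₁⟩ := hwin e he
  obtain ⟨N₂, hN₂⟩ := hstat e he
  obtain ⟨N₃, hN₃⟩ := hcw τ hτ e he
  -- uniform continuity of the static rate on the compact `[0, t]`; the windows shrink, `w_N = τ (N+1)^{-1/3} → 0`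
  obtain ⟨δ, hδ, hUC⟩ := Metric.uniformContinuousOn_iff_le.1 (isCompact_Icc.uniformContinuousOn_of_continuous hCst) e he
  have hwlim : Tendsto (fun N : ℕ => τ * ((N : ℝ) + 1) ^ (-(1 / 3 : ℝ))) atTop (𝓝 0) := by
    have h := ((tendsto_rpow_neg_atTop (by norm_num : (0 : ℝ) < 1 / 3)).comp
      (tendsto_atTop_add_const_right _ 1 tendsto_natCast_atTop_atTop)).const_mul τ
    rw [mul_zero] at h
    exact h
  have hKlim := hwlim.const_mul K
  rw [mul_zero] at hKlim
  obtain ⟨N₄, hN₄⟩ := eventually_atTop.1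
    ((hwlim.eventually_le_const hδ).and (hKlim.eventually_le_const (by norm_num : (0 : ℝ) < 1 / 2)))
  refine ⟨max N₁ (max N₂ (max N₃ N₄)), fun N hN t' ht' => ?_⟩
  simp only [max_le_iff] at hN
  obtain ⟨hN1, hN2, hN3, hN4⟩ := hN
  obtain ⟨hwδ, hKw⟩ := hN₄ N hN4
  obtain ⟨B, hBN⟩ := hA r Rf hr hbd hcont a₀ θ₀ u₀ ha hθ hu ha0 hθ0 σ hσ hσh T ρ θ u hEul t ht hpack N (Φ N)
  have key := integrated_of_windows
    (H := fun s => (klDiv ((Φ N).lawAt (localGibbsLaw σ a₀ u₀ θ₀ N (Φ N)) s)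
      (localGibbsLaw σ (fun x => ρ s x * Rf (σ ^ 3 * ρ s x)) (u s) (θ s) N (Φ N))).toReal)
    (L := fun s => Real.log (posPartition (fun x => ρ s x * Rf (σ ^ 3 * ρ s x)) (hsDiameter σ N) (N + 1)))
    (Cst := Cst) (t := t) (M := (N : ℝ) + 1) (K := K) (w := τ * ((N : ℝ) + 1) ^ (-(1 / 3 : ℝ))) (e := e)
    (B := max B 0) (by positivity) hK (mul_pos hτ (Real.rpow_pos_of_pos (by positivity) _)) he.le hKw
    (fun s => ENNReal.toReal_nonneg)
    (fun s hs => ENNReal.toReal_le_of_le_ofReal (le_max_right _ _)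
      ((hBN s hs).trans (ENNReal.ofReal_le_ofReal (le_max_left _ _))))
    (by simp only [hlaw0 N, EntropyClockDock.klDiv_lawAt_zero_localGibbsLaw hσh.le ha hθ hu ha0 hθ0 N (Φ N),
          ENNReal.toReal_zero])
    (hN₁ N hN1) (hN₂ N hN2) (hN₃ N hN3) hCst
    (fun x hx y hy hxy hyx => by
      have h := hUC y hy x hx (by rw [Real.dist_eq, abs_of_nonneg (sub_nonneg.2 hxy)]; linarith)
      rwa [Real.dist_eq] at h)
    ht'
  have h4t : (4 : ℝ) * (1 + t) ≠ 0 := by positivity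
  have hεe : ((N : ℝ) + 1) * (4 * (1 + t) * e) = ((N : ℝ) + 1) * ε := by rw [he_def]; field_simp
  rwa [hεe] at key

end Summit.AtomisticToContinuum.HydrodynamicLimit.Theorems.ClampedCurrentsDockFromWindows

end
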